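import Summits.QuantumFields.BalabanUV.Beta.D1BFx.ChartDefectTwoPinsLiteral
import Summits.QuantumFields.BalabanUV.Beta.D1BFx.ChartDefectTwoPinsRoad
import Summits.QuantumFields.BalabanUV.Beta.D1BFx.ChartDefectWordsLiteral
import Summits.QuantumFields.BalabanUV.Beta.D1BFx.HessKerConjugation

/-!
# `BalabanUV.Beta.D1BFx.ChartDefectTwoPins` — road «BF-x», binder row D1, PART 24 HEAD (H3-Δ) at the RECORD (`PART24-HEAD-SPEC-g24.md` v1.1 §3;
# an2 R-D1-g45-5: «identities at both pins FIRST, prices only on (H3-Δ)'s rows»): **THE CHART DEFECT OF THE (J1) ROW, WORD BY WORD** — the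
# literal of record's one-loop word minus the road's word at its own kernel,
# `Δ_n μ ν z := TOf (JsB12CombShSym … 0) μ ν z − hessKer G₀ (vertexOfK G₀ n S⁰) (vertex2OfK G₀ n S₂⁰) μ ν z`
# (PART 23-hyb's displayed defect `RJ1` at one blocking — `ChartDefectWordsLiteral.RJ1_JcOfTabs_eq_words`' left side at `n := Lc^m`), IS A SUM OF NAMED WORDS:
# with both pins in the tree — `ChartDefectTwoPinsLiteral.hessKer_literal_record_eq` (`T_lit = hessKer G′ V^s W_L`) and `ChartDefectTwoPinsRoad.hessKer_G0bm_record_eq`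
# (`T_road = hessKer G₀ (V^s + G^{Dsh}) W_R`), `V^s := vertexOfK K₀ n S⁰` —
# `Δ_n = [hessKer G′ V^s W_L − hessKer G₀ V^s W_L]` (the three `Dsh`-INSERTION words of `ColumnGaugeTwoPins.hessKer_GcombSh_sub_hessKer_G0bm`, `G′ = G₀ − G₀∘Dsh∘G′`)
# `+ ½·tadpole G₀ ((W_L − W_R) μ 0 ν z)` split word by word — the (D-R) rest `W2SymOfK K₀ … − vertex2OfK K₀ S₂⁰`, the mixed column word `W^{Mcol}_c`, leaf-03's
# site-law mixed word `WMs[G₀]`, the face Λ-sector word `W^{Λ}_f`, and `−W^{Dsh} = [Λc ν, [Λc μ, Dsh]]`; the column Λ-sector word `W^{Λ}_c` sits at BOTH pins and CANCELS —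
# `+ ½·(bubble G₀ (V^s μ 0) (G^{Dsh} ν z) + bubble G₀ (G^{Dsh} μ 0) (V^s ν z)) + ½·bubble G₀ (G^{Dsh} μ 0) (G^{Dsh} ν z)` (`HessKerConjugation.hessKer_add_left_sub`).
# Every word is NAMED and written out; NONE is bounded here (the HEAD skeleton prices them: rows (a)–(e)).

HONEST DEPENDENCY (cell records, verbatim): «continuum YM on T⁴ ⇐ BetaPertH ∧ nine spine estimates (0/9 proved); BetaPertH ⇐ (D1) ∧ (D4) ∧
CAP+tail; G-an2-4 gates asym, D1 and NE2/3/4.»  HONEST FRAMING (cell contract, verbatim): «discharging `BetaPertH` makes Bałaban's UV stability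
UNCONDITIONAL — a real constructive-QFT result; it is NOT the continuum limit and NOT the Clay problem.»  THIS MODULE DISCHARGES NO binder of row D1 and
NO estimate of Bałaban's: one [our object] identity between OUR kernels composed BY NAME from the two pins; the colour data `Complete τ`, `TrOrthonormal τ`,
`N ≠ 0`, `c` of leaf-09's Wilson letters are HYPOTHESES (displayed); prices NO row; no definition, no `def … : Prop`, nothing cited, 0 sorry;
one `set_option maxHeartbeats 400000 in` (statement elaboration of the written-out word list only — cf. `PointColumnDecay`, `GhostLegFree`).
0∕4 row-D1 binders; (K) NOT closed; (J1) ONE OPEN ROW `hC₁ := Δ_n`; NOT D1, NEVER «G-an2-4 closed», NOT `BetaPertH`, NOT continuum, NOT Clay.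

ABSOLUTE RULE (cell charter, verbatim): «No internally-minted statement may enter as a cited fact. Every hypothesis is either kernel-proved in this
package or a verbatim quotation of a PUBLISHED theorem with page reference. The manuscript(s) under audit are NOT citable for their own disputed
steps — they are the thing under adjudication; programme-internal (2001/route/tribunal) claims are never citable.»

Unit `b2b-balaban-beta-d1-p2` (road owner, gen 25), 2026-08-23; no existing file touched.
-/

noncomputable section

namespace Summit.QuantumFields.BalabanUV.Beta.D1BFx.ChartDefectTwoPins

open Finset
open scoped BigOperators
open Literature.MathematicalPhysics.QuantumFieldTheory
open Literature.MathematicalPhysics.QuantumFieldTheory.LatticeForm (quo)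
open Literature.MathematicalPhysics.QuantumFieldTheory.Balaban1983to89
open Literature.MathematicalPhysics.QuantumFieldTheory.Balaban1983to89.Beta
open B12Sec2to5 (l1)
open B4ContourShift (supNorm)
open ColourTrace (Complete TrOrthonormal)
open WilsonVertex2Sym (wsym22)
open WilsonBiStencil (wilsonW₂)
open StepJetData (wilsonA)
open AveragingHessianKernels (ell)
open ExpKernelCalculus (MKer VertexFamily comp tr tadpole bubble hessKer)
open OneStepResolventKernel (Fib LocStencil TOf)
open OneStepKernelFamily (colH vertexOfK KInvStep)
open SecondOrderResponse (vertexOfM dM K2OfK mixOfK W2OfK W2SymOfK vertex2OfK LocStencilFM vertexFamily_vertexOfM)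
open BalabanCompositeJets (LocStencil₂)
open BalabanStepW2 (M2Of vertexFamily_mono')
open AffineAveraging (Site box toSite)
open AveragingContours (blk)
open AveragingContoursRooted (ctr ctrOff ctrOff_mem_box)
open Summit.QuantumFields.BalabanUV.Beta.TameKernelCalculus (Spr Loc trK decays_of_le tadpole_add)
open Summit.QuantumFields.BalabanUV.Beta.KernelWardRelative (tadpole_sub)
open Summit.QuantumFields.BalabanUV.Beta.BorderedHessian (diagK bhK sgnK spr_KInvStep)
open Summit.QuantumFields.BalabanUV.Beta.DshAn1 (Dsh spr_Dsh)
open Summit.QuantumFields.BalabanUV.Beta.ChartConjugation (conjV)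
open Summit.QuantumFields.BalabanUV.Beta.AxialDressingRooted (coDressKBmAt axEc)
open Summit.QuantumFields.BalabanUV.Beta.AxialProjectorBlockMean (bmGaugeAt)
open Summit.QuantumFields.BalabanUV.Beta.AveragingWardRootedStencils (legSite)
open Summit.QuantumFields.BalabanUV.Beta.SymAveragingHessianCounts (symVhSAt symHessFFAt vertexFamily_symHessFFAt)
open Summit.QuantumFields.BalabanUV.Beta.SymSecondOrderTablesAn1 (symVh₂SAn1 symTablesAn1S2)
open Summit.QuantumFields.BalabanUV.Beta.CombChartStepJets (GcombSh JsB12CombSh0)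
open Summit.QuantumFields.BalabanUV.Beta.CombChartJointEnd (JsB12CombShSym)
open Summit.QuantumFields.BalabanUV.Beta.CompositeCorrectorLocality (blockSitesF)
open Summit.QuantumFields.BalabanUV.Beta.SymCorrectorFace (faceWt)
open Summit.QuantumFields.BalabanUV.Beta.SymCorrectorFaceGauge (loc_faceGauge)
open Summit.QuantumFields.BalabanUV.Beta.SymCorrectorW2Gauge (loc_faceGen)
open Summit.QuantumFields.BalabanUV.Beta.SymCorrectorMixedSiteNull (locStencilFM_anchor)
open Summit.QuantumFields.BalabanUV.Beta.SymCorrectorResponseNull (loc_dM_K2OfK)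
open Summit.QuantumFields.BalabanUV.Beta.SymCorrectorLiteralLoc (locStencilFM_literalM₂ loc_mixOfK_of_spr)
open Summit.QuantumFields.BalabanUV.Beta.SpineRooted (T2RecOf_zero_level)
open Summit.QuantumFields.BalabanUV.Beta.CombSecondOrderClassBase (locStencil₂_T2RecOf_symTablesAn1)
open Summit.QuantumFields.BalabanUV.Beta.D1BFx.ChartDefectResolvent (spr_G0bm_ctr spr_GcombSh_zero GcombSh_zero_eq_sub_defect)
open Summit.QuantumFields.BalabanUV.Beta.D1BFx.RawStencilSupportRows (locStencil_JsB12CombSh0_S_zero_of_decays locStencil_pure_zero)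
open Summit.QuantumFields.BalabanUV.Beta.D1BFx.PackedColumnEnvelope (abs_colH_KInvStep_zero_le)
open Summit.QuantumFields.BalabanUV.Beta.D1BFx.DressedVertexSplit (abs_bmGaugeAt_weight_le)
open Summit.QuantumFields.BalabanUV.Beta.D1BFx.ColumnGaugeNativeFirstOrder (loc_diagK_weight_legSite)
open Summit.QuantumFields.BalabanUV.Beta.D1BFx.ColumnGaugeInvariance (loc_comm_spr)
open Summit.QuantumFields.BalabanUV.Beta.D1BFx.ColumnGaugeTwoPins (tadpole_sub_tadpole_of_insertion bubble_sub_bubble_of_insertion)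
open Summit.QuantumFields.BalabanUV.Beta.D1BFx.HessKerConjugation (bubble_add_add)
open Summit.QuantumFields.BalabanUV.Beta.D1BFx.ChartDefectWords (loc_vertexOfK_of_spr loc_vertex2OfK_of_spr)
open Summit.QuantumFields.BalabanUV.Beta.D1BFx.ChartDefectWordsLiteral (TOf_JsB12CombShSym_eq_hessKer_GcombSh)
open Summit.QuantumFields.BalabanUV.Beta.D1BFx.ChartDefectTwoPinsLiteral (hessKer_literal_record_eq)
open Summit.QuantumFields.BalabanUV.Beta.D1BFx.ChartDefectTwoPinsRoad (hessKer_G0bm_record_eq)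
open B5Hk163Strip (kappa163 kappa163_pos)
open B5Hk163Decay (MG163)
open B4TorusKernel (periodConst)

variable {n : ℕ} [NeZero n] {N : ℕ} {C : Type*} [Fintype C] [DecidableEq C] {τ : C → Matrix (Fin N) (Fin N) ℂ}

set_option maxHeartbeats 400000 in
/-- **(H3-Δ) THE CHART DEFECT OF THE (J1) ROW AT THE RECORD, WORD BY WORD** [our object].  For the literal of record
`JsB12CombShSym hodd N (symTablesAn1S2 3 n cΛ) cΛ (−n¹²∕4)` at one blocking (`n` odd) and the road's word at its own kernel `G₀ = coDressKBmAt ρ_c n K₀`,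
`TOf (JsB12CombShSym … 0) μ₀ ν₀ z₀ − hessKer G₀ (vertexOfK G₀ n S⁰) (vertex2OfK G₀ n S₂⁰) μ₀ ν₀ z₀` — PART 23-hyb's displayed defect `RJ1` at one blocking, the left side of
`ChartDefectWordsLiteral.RJ1_JcOfTabs_eq_words` at `n := Lc^m` — EQUALS the sum of NAMED words (each written out, none bounded):
the three `Dsh`-INSERTION words of `ColumnGaugeTwoPins.hessKer_GcombSh_sub_hessKer_G0bm` at `V := V^s = vertexOfK K₀ n S⁰`, `W := W_L` (the literal pin's displaced family of
`ChartDefectTwoPinsLiteral.hessKer_literal_record_eq`) `+ ½·tadpole G₀ ((W2SymOfK K₀ n S♭ M⁰ S₂⁰ M₂⁰ − vertex2OfK K₀ n S₂⁰) μ₀ 0 ν₀ z₀)` (the (D-R) rest)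
`+ ½·tadpole G₀ (W^{Mcol}_c μ₀ 0 ν₀ z₀) + ½·tadpole G₀ (WMs[G₀] μ₀ 0 ν₀ z₀) + ½·tadpole G₀ (W^{Λ}_f μ₀ 0 ν₀ z₀)` (mixed column ∕ mixed face ∕ Λ-sector face words)
`+ ½·tadpole G₀ ([Λc ν₀ z₀, [Λc μ₀ 0, Dsh n]])` (`= −½·tadpole G₀ (W^{Dsh} μ₀ 0 ν₀ z₀)` of `ChartDefectTwoPinsRoad.hessKer_G0bm_record_eq`)
`+ ½·(bubble G₀ (V^s μ₀ 0) (G^{Dsh} ν₀ z₀) + bubble G₀ (G^{Dsh} μ₀ 0) (V^s ν₀ z₀)) + ½·bubble G₀ (G^{Dsh} μ₀ 0) (G^{Dsh} ν₀ z₀)` (`G^{Dsh} μ y = [Λc μ y, Dsh n]`).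
The column Λ-sector word `W^{Λ}_c` is displaced identically at both pins and CANCELS.  Colour data `Complete τ`, `TrOrthonormal τ`, `N ≠ 0`, `c` are the
HYPOTHESES of the record's Wilson letters (both pins), displayed.  (`maxHeartbeats 400000`: the ELABORATION OF THIS STATEMENT — ≈ 120 written-out lines,
thirty block sums — passes the default budget by itself; the proof is `rw` ∕ `unfold` ∕ one `linear_combination`, no search.) -/
theorem chartDefect_record_eq_words (hodd : Odd n) (hτ : Complete τ) (ho : TrOrthonormal τ) (hN : N ≠ 0) (c : C) (cΛ : ℝ)
    (μ₀ ν₀ : Fin 4) (z₀ : Site 4) :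
    TOf (N := n) (JsB12CombShSym hodd N (symTablesAn1S2 3 n cΛ) cΛ (-((n : ℝ) ^ 12 / 4)) 0) μ₀ ν₀ z₀
        - hessKer (coDressKBmAt (ctr 4 n) n (KInvStep (d := 3) n 0))
            (vertexOfK (coDressKBmAt (ctr 4 n) n (KInvStep (d := 3) n 0)) n (JsB12CombSh0 hodd N (symTablesAn1S2 3 n cΛ) cΛ (-((n : ℝ) ^ 12 / 4)) 0).S)
            (vertex2OfK (coDressKBmAt (ctr 4 n) n (KInvStep (d := 3) n 0)) n
              (fun κ u κ' u' => ((n : ℝ) ^ 8) • wilsonW₂ 3 ((8 * (N : ℝ) ^ 2)⁻¹ • wsym22 N) κ u κ' u' + (-((n : ℝ) ^ 12 / 4)) • symVh₂SAn1 3 n κ u κ' u')) μ₀ ν₀ z₀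
      = (-((1 / 2) * tr (comp (comp (comp (coDressKBmAt (ctr 4 n) n (KInvStep (d := 3) n 0)) (Dsh n)) (GcombSh (d := 3) n 0)) (W2SymOfK (KInvStep (d := 3) n 0) n (fun κ u => ((n : ℝ) ^ 4) • wilsonA 3 κ u + (-((n : ℝ) ^ 8 / 2)) • symVhSAt (ctr 4 n) 3 n rfl κ u)
              ((symTablesAn1S2 3 n cΛ).M 0) (fun κ u κ' u' => ((n : ℝ) ^ 8) • wilsonW₂ 3 ((8 * (N : ℝ) ^ 2)⁻¹ • wsym22 N) κ u κ' u' + (-((n : ℝ) ^ 12 / 4)) • symVh₂SAn1 3 n κ u κ' u')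
              (M2Of 3 n (symTablesAn1S2 3 n cΛ).mixFF 0) μ₀ 0 ν₀ z₀
          + ((((comp (diagK fun z' b => (n : ℝ) ^ 4 / 2 * bmGaugeAt (ctr 4 n) (colH (KInvStep (d := 3) n 0) n ν₀ z₀) n (legSite (ctr 4 n) z' b)) (vertexOfK (KInvStep (d := 3) n 0) n (fun κ u => ((n : ℝ) ^ 4) • wilsonA 3 κ u + (-((n : ℝ) ^ 8 / 2)) • symVhSAt (ctr 4 n) 3 n rfl κ u) μ₀ 0)
                - comp (vertexOfK (KInvStep (d := 3) n 0) n (fun κ u => ((n : ℝ) ^ 4) • wilsonA 3 κ u + (-((n : ℝ) ^ 8 / 2)) • symVhSAt (ctr 4 n) 3 n rfl κ u) μ₀ 0) (diagK fun z' b => (n : ℝ) ^ 4 / 2 * bmGaugeAt (ctr 4 n) (colH (KInvStep (d := 3) n 0) n ν₀ z₀) n (legSite (ctr 4 n) z' b)))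
              + (comp (diagK fun z' b => (n : ℝ) ^ 4 / 2 * bmGaugeAt (ctr 4 n) (colH (KInvStep (d := 3) n 0) n μ₀ 0) n (legSite (ctr 4 n) z' b)) (vertexOfK (KInvStep (d := 3) n 0) n (fun κ u => ((n : ℝ) ^ 4) • wilsonA 3 κ u + (-((n : ℝ) ^ 8 / 2)) • symVhSAt (ctr 4 n) 3 n rfl κ u) ν₀ z₀)
                - comp (vertexOfK (KInvStep (d := 3) n 0) n (fun κ u => ((n : ℝ) ^ 4) • wilsonA 3 κ u + (-((n : ℝ) ^ 8 / 2)) • symVhSAt (ctr 4 n) 3 n rfl κ u) ν₀ z₀) (diagK fun z' b => (n : ℝ) ^ 4 / 2 * bmGaugeAt (ctr 4 n) (colH (KInvStep (d := 3) n 0) n μ₀ 0) n (legSite (ctr 4 n) z' b)))))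
            - (((comp (diagK fun z' b => (n : ℝ) ^ 4 / 2 * bmGaugeAt (ctr 4 n) (colH (KInvStep (d := 3) n 0) n ν₀ z₀) n (legSite (ctr 4 n) z' b)) (vertexOfK (KInvStep (d := 3) n 0) n (JsB12CombSh0 hodd N (symTablesAn1S2 3 n cΛ) cΛ (-((n : ℝ) ^ 12 / 4)) 0).S μ₀ 0)
                - comp (vertexOfK (KInvStep (d := 3) n 0) n (JsB12CombSh0 hodd N (symTablesAn1S2 3 n cΛ) cΛ (-((n : ℝ) ^ 12 / 4)) 0).S μ₀ 0) (diagK fun z' b => (n : ℝ) ^ 4 / 2 * bmGaugeAt (ctr 4 n) (colH (KInvStep (d := 3) n 0) n ν₀ z₀) n (legSite (ctr 4 n) z' b)))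
              + (comp (diagK fun z' b => (n : ℝ) ^ 4 / 2 * bmGaugeAt (ctr 4 n) (colH (KInvStep (d := 3) n 0) n μ₀ 0) n (legSite (ctr 4 n) z' b)) (vertexOfK (KInvStep (d := 3) n 0) n (JsB12CombSh0 hodd N (symTablesAn1S2 3 n cΛ) cΛ (-((n : ℝ) ^ 12 / 4)) 0).S ν₀ z₀)
                - comp (vertexOfK (KInvStep (d := 3) n 0) n (JsB12CombSh0 hodd N (symTablesAn1S2 3 n cΛ) cΛ (-((n : ℝ) ^ 12 / 4)) 0).S ν₀ z₀) (diagK fun z' b => (n : ℝ) ^ 4 / 2 * bmGaugeAt (ctr 4 n) (colH (KInvStep (d := 3) n 0) n μ₀ 0) n (legSite (ctr 4 n) z' b))))))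
          + ((mixOfK (coDressKBmAt (ctr 4 n) n (KInvStep (d := 3) n 0)) n (M2Of 3 n (symTablesAn1S2 3 n cΛ).mixFF 0) μ₀ 0 ν₀ z₀
                - mixOfK (KInvStep (d := 3) n 0) n (M2Of 3 n (symTablesAn1S2 3 n cΛ).mixFF 0) μ₀ 0 ν₀ z₀)
            + (mixOfK (coDressKBmAt (ctr 4 n) n (KInvStep (d := 3) n 0)) n (M2Of 3 n (symTablesAn1S2 3 n cΛ).mixFF 0) ν₀ z₀ μ₀ 0
                - mixOfK (KInvStep (d := 3) n 0) n (M2Of 3 n (symTablesAn1S2 3 n cΛ).mixFF 0) ν₀ z₀ μ₀ 0))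
          + (((mixOfK (coDressKBmAt (ctr 4 n) n (KInvStep (d := 3) n 0)) n (fun κ u ρ w => (if blk n ((n : ℤ) • w + (ctr 4 n)) = blk n u then 2 * faceWt (ctrOff 4 n) n κ u else 0) • (symHessFFAt (ctr 4 n) n) ρ w) μ₀ 0 ν₀ z₀
                + mixOfK (coDressKBmAt (ctr 4 n) n (KInvStep (d := 3) n 0)) n (fun κ u ρ w => (if blk n ((n : ℤ) • w + (ctr 4 n)) = blk n u then 2 * faceWt (ctrOff 4 n) n κ u else 0) • (symHessFFAt (ctr 4 n) n) ρ w) ν₀ z₀ μ₀ 0)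
              - (comp (diagK fun z b => ∑ α : Fin (3 + 1), ∑ x ∈ blockSitesF n (blk n (legSite (ctr 4 n) z b)), colH (coDressKBmAt (ctr 4 n) n (KInvStep (d := 3) n 0)) n μ₀ 0 α x * (2 * faceWt (ctrOff 4 n) n α x)) (vertexOfM (coDressKBmAt (ctr 4 n) n (KInvStep (d := 3) n 0)) n (symHessFFAt (ctr 4 n) n) ν₀ z₀)
                + comp (diagK fun z b => ∑ α : Fin (3 + 1), ∑ x ∈ blockSitesF n (blk n (legSite (ctr 4 n) z b)), colH (coDressKBmAt (ctr 4 n) n (KInvStep (d := 3) n 0)) n ν₀ z₀ α x * (2 * faceWt (ctrOff 4 n) n α x)) (vertexOfM (coDressKBmAt (ctr 4 n) n (KInvStep (d := 3) n 0)) n (symHessFFAt (ctr 4 n) n) μ₀ 0)))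
          + ((((comp (diagK fun z b => -(∑ α : Fin (3 + 1), ∑ x ∈ blockSitesF n (blk n (legSite (ctr 4 n) z b)), colH (coDressKBmAt (ctr 4 n) n (KInvStep (d := 3) n 0)) n ν₀ z₀ α x * (((n : ℝ) ^ 4 / 2) * faceWt (ctrOff 4 n) n α x))) (vertexOfK (coDressKBmAt (ctr 4 n) n (KInvStep (d := 3) n 0)) n (fun κ u => ((n : ℝ) ^ 4) • wilsonA 3 κ u + (-((n : ℝ) ^ 8 / 2)) • symVhSAt (ctr 4 n) 3 n rfl κ u) μ₀ 0)
                - comp (vertexOfK (coDressKBmAt (ctr 4 n) n (KInvStep (d := 3) n 0)) n (fun κ u => ((n : ℝ) ^ 4) • wilsonA 3 κ u + (-((n : ℝ) ^ 8 / 2)) • symVhSAt (ctr 4 n) 3 n rfl κ u) μ₀ 0) (diagK fun z b => -(∑ α : Fin (3 + 1), ∑ x ∈ blockSitesF n (blk n (legSite (ctr 4 n) z b)), colH (coDressKBmAt (ctr 4 n) n (KInvStep (d := 3) n 0)) n ν₀ z₀ α x * (((n : ℝ) ^ 4 / 2) * faceWt (ctrOff 4 n) n α x))))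
              + (comp (diagK fun z b => -(∑ α : Fin (3 + 1), ∑ x ∈ blockSitesF n (blk n (legSite (ctr 4 n) z b)), colH (coDressKBmAt (ctr 4 n) n (KInvStep (d := 3) n 0)) n μ₀ 0 α x * (((n : ℝ) ^ 4 / 2) * faceWt (ctrOff 4 n) n α x))) (vertexOfK (coDressKBmAt (ctr 4 n) n (KInvStep (d := 3) n 0)) n (fun κ u => ((n : ℝ) ^ 4) • wilsonA 3 κ u + (-((n : ℝ) ^ 8 / 2)) • symVhSAt (ctr 4 n) 3 n rfl κ u) ν₀ z₀)
                - comp (vertexOfK (coDressKBmAt (ctr 4 n) n (KInvStep (d := 3) n 0)) n (fun κ u => ((n : ℝ) ^ 4) • wilsonA 3 κ u + (-((n : ℝ) ^ 8 / 2)) • symVhSAt (ctr 4 n) 3 n rfl κ u) ν₀ z₀) (diagK fun z b => -(∑ α : Fin (3 + 1), ∑ x ∈ blockSitesF n (blk n (legSite (ctr 4 n) z b)), colH (coDressKBmAt (ctr 4 n) n (KInvStep (d := 3) n 0)) n μ₀ 0 α x * (((n : ℝ) ^ 4 / 2) * faceWt (ctrOff 4 n) n α x))))))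
            - (((comp (diagK fun z b => -(∑ α : Fin (3 + 1), ∑ x ∈ blockSitesF n (blk n (legSite (ctr 4 n) z b)), colH (coDressKBmAt (ctr 4 n) n (KInvStep (d := 3) n 0)) n ν₀ z₀ α x * (((n : ℝ) ^ 4 / 2) * faceWt (ctrOff 4 n) n α x))) (vertexOfK (coDressKBmAt (ctr 4 n) n (KInvStep (d := 3) n 0)) n (JsB12CombSh0 hodd N (symTablesAn1S2 3 n cΛ) cΛ (-((n : ℝ) ^ 12 / 4)) 0).S μ₀ 0)
                - comp (vertexOfK (coDressKBmAt (ctr 4 n) n (KInvStep (d := 3) n 0)) n (JsB12CombSh0 hodd N (symTablesAn1S2 3 n cΛ) cΛ (-((n : ℝ) ^ 12 / 4)) 0).S μ₀ 0) (diagK fun z b => -(∑ α : Fin (3 + 1), ∑ x ∈ blockSitesF n (blk n (legSite (ctr 4 n) z b)), colH (coDressKBmAt (ctr 4 n) n (KInvStep (d := 3) n 0)) n ν₀ z₀ α x * (((n : ℝ) ^ 4 / 2) * faceWt (ctrOff 4 n) n α x))))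
              + (comp (diagK fun z b => -(∑ α : Fin (3 + 1), ∑ x ∈ blockSitesF n (blk n (legSite (ctr 4 n) z b)), colH (coDressKBmAt (ctr 4 n) n (KInvStep (d := 3) n 0)) n μ₀ 0 α x * (((n : ℝ) ^ 4 / 2) * faceWt (ctrOff 4 n) n α x))) (vertexOfK (coDressKBmAt (ctr 4 n) n (KInvStep (d := 3) n 0)) n (JsB12CombSh0 hodd N (symTablesAn1S2 3 n cΛ) cΛ (-((n : ℝ) ^ 12 / 4)) 0).S ν₀ z₀)
                - comp (vertexOfK (coDressKBmAt (ctr 4 n) n (KInvStep (d := 3) n 0)) n (JsB12CombSh0 hodd N (symTablesAn1S2 3 n cΛ) cΛ (-((n : ℝ) ^ 12 / 4)) 0).S ν₀ z₀) (diagK fun z b => -(∑ α : Fin (3 + 1), ∑ x ∈ blockSitesF n (blk n (legSite (ctr 4 n) z b)), colH (coDressKBmAt (ctr 4 n) n (KInvStep (d := 3) n 0)) n μ₀ 0 α x * (((n : ℝ) ^ 4 / 2) * faceWt (ctrOff 4 n) n α x)))))))))))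
        + (1 / 2) * (tr (comp (comp (comp (comp (coDressKBmAt (ctr 4 n) n (KInvStep (d := 3) n 0)) (Dsh n)) (GcombSh (d := 3) n 0)) (vertexOfK (KInvStep (d := 3) n 0) n (JsB12CombSh0 hodd N (symTablesAn1S2 3 n cΛ) cΛ (-((n : ℝ) ^ 12 / 4)) 0).S μ₀ 0)) (comp (GcombSh (d := 3) n 0) (vertexOfK (KInvStep (d := 3) n 0) n (JsB12CombSh0 hodd N (symTablesAn1S2 3 n cΛ) cΛ (-((n : ℝ) ^ 12 / 4)) 0).S ν₀ z₀)))
          + tr (comp (comp (coDressKBmAt (ctr 4 n) n (KInvStep (d := 3) n 0)) (vertexOfK (KInvStep (d := 3) n 0) n (JsB12CombSh0 hodd N (symTablesAn1S2 3 n cΛ) cΛ (-((n : ℝ) ^ 12 / 4)) 0).S μ₀ 0)) (comp (comp (comp (coDressKBmAt (ctr 4 n) n (KInvStep (d := 3) n 0)) (Dsh n)) (GcombSh (d := 3) n 0)) (vertexOfK (KInvStep (d := 3) n 0) n (JsB12CombSh0 hodd N (symTablesAn1S2 3 n cΛ) cΛ (-((n : ℝ) ^ 12 / 4)) 0).S ν₀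 z₀)))))
        + (1 / 2) * tadpole (coDressKBmAt (ctr 4 n) n (KInvStep (d := 3) n 0)) (W2SymOfK (KInvStep (d := 3) n 0) n (fun κ u => ((n : ℝ) ^ 4) • wilsonA 3 κ u + (-((n : ℝ) ^ 8 / 2)) • symVhSAt (ctr 4 n) 3 n rfl κ u)
              ((symTablesAn1S2 3 n cΛ).M 0) (fun κ u κ' u' => ((n : ℝ) ^ 8) • wilsonW₂ 3 ((8 * (N : ℝ) ^ 2)⁻¹ • wsym22 N) κ u κ' u' + (-((n : ℝ) ^ 12 / 4)) • symVh₂SAn1 3 n κ u κ' u')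
              (M2Of 3 n (symTablesAn1S2 3 n cΛ).mixFF 0) μ₀ 0 ν₀ z₀
            - vertex2OfK (KInvStep (d := 3) n 0) n
              (fun κ u κ' u' => ((n : ℝ) ^ 8) • wilsonW₂ 3 ((8 * (N : ℝ) ^ 2)⁻¹ • wsym22 N) κ u κ' u' + (-((n : ℝ) ^ 12 / 4)) • symVh₂SAn1 3 n κ u κ' u') μ₀ 0 ν₀ z₀)
        + (1 / 2) * tadpole (coDressKBmAt (ctr 4 n) n (KInvStep (d := 3) n 0)) (((mixOfK (coDressKBmAt (ctr 4 n) n (KInvStep (d := 3) n 0)) n (M2Of 3 n (symTablesAn1S2 3 n cΛ).mixFF 0) μ₀ 0 ν₀ z₀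
                - mixOfK (KInvStep (d := 3) n 0) n (M2Of 3 n (symTablesAn1S2 3 n cΛ).mixFF 0) μ₀ 0 ν₀ z₀)
            + (mixOfK (coDressKBmAt (ctr 4 n) n (KInvStep (d := 3) n 0)) n (M2Of 3 n (symTablesAn1S2 3 n cΛ).mixFF 0) ν₀ z₀ μ₀ 0
                - mixOfK (KInvStep (d := 3) n 0) n (M2Of 3 n (symTablesAn1S2 3 n cΛ).mixFF 0) ν₀ z₀ μ₀ 0)))
        + (1 / 2) * tadpole (coDressKBmAt (ctr 4 n) n (KInvStep (d := 3) n 0)) (((mixOfK (coDressKBmAt (ctr 4 n) n (KInvStep (d := 3) n 0)) n (fun κ u ρ w => (if blk n ((n : ℤ) • w + (ctr 4 n)) = blk n u then 2 * faceWt (ctrOff 4 n) n κ u else 0) • (symHessFFAt (ctr 4 n) n) ρ w) μ₀ 0 ν₀ z₀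
                + mixOfK (coDressKBmAt (ctr 4 n) n (KInvStep (d := 3) n 0)) n (fun κ u ρ w => (if blk n ((n : ℤ) • w + (ctr 4 n)) = blk n u then 2 * faceWt (ctrOff 4 n) n κ u else 0) • (symHessFFAt (ctr 4 n) n) ρ w) ν₀ z₀ μ₀ 0)
              - (comp (diagK fun z b => ∑ α : Fin (3 + 1), ∑ x ∈ blockSitesF n (blk n (legSite (ctr 4 n) z b)), colH (coDressKBmAt (ctr 4 n) n (KInvStep (d := 3) n 0)) n μ₀ 0 α x * (2 * faceWt (ctrOff 4 n) n α x)) (vertexOfM (coDressKBmAt (ctr 4 n) n (KInvStep (d := 3) n 0)) n (symHessFFAt (ctr 4 n) n) ν₀ z₀)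
                + comp (diagK fun z b => ∑ α : Fin (3 + 1), ∑ x ∈ blockSitesF n (blk n (legSite (ctr 4 n) z b)), colH (coDressKBmAt (ctr 4 n) n (KInvStep (d := 3) n 0)) n ν₀ z₀ α x * (2 * faceWt (ctrOff 4 n) n α x)) (vertexOfM (coDressKBmAt (ctr 4 n) n (KInvStep (d := 3) n 0)) n (symHessFFAt (ctr 4 n) n) μ₀ 0))))
        + (1 / 2) * tadpole (coDressKBmAt (ctr 4 n) n (KInvStep (d := 3) n 0)) ((((comp (diagK fun z b => -(∑ α : Fin (3 + 1), ∑ x ∈ blockSitesF n (blk n (legSite (ctr 4 n) z b)), colH (coDressKBmAt (ctr 4 n) n (KInvStep (d := 3) n 0)) n ν₀ z₀ α x * (((n : ℝ) ^ 4 / 2) * faceWt (ctrOff 4 n) n α x))) (vertexOfK (coDressKBmAt (ctr 4 n) n (KInvStep (d := 3) n 0)) n (fun κ u => ((n : ℝ) ^ 4) • wilsonA 3 κ u + (-((n : ℝ) ^ 8 / 2)) • symVhSAt (ctr 4 n) 3 n rfl κ u) μ₀ 0)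
                - comp (vertexOfK (coDressKBmAt (ctr 4 n) n (KInvStep (d := 3) n 0)) n (fun κ u => ((n : ℝ) ^ 4) • wilsonA 3 κ u + (-((n : ℝ) ^ 8 / 2)) • symVhSAt (ctr 4 n) 3 n rfl κ u) μ₀ 0) (diagK fun z b => -(∑ α : Fin (3 + 1), ∑ x ∈ blockSitesF n (blk n (legSite (ctr 4 n) z b)), colH (coDressKBmAt (ctr 4 n) n (KInvStep (d := 3) n 0)) n ν₀ z₀ α x * (((n : ℝ) ^ 4 / 2) * faceWt (ctrOff 4 n) n α x))))
              + (comp (diagK fun z b => -(∑ α : Fin (3 + 1), ∑ x ∈ blockSitesF n (blk n (legSite (ctr 4 n) z b)), colH (coDressKBmAt (ctr 4 n) n (KInvStep (d := 3) n 0)) n μ₀ 0 α x * (((n : ℝ) ^ 4 / 2) * faceWt (ctrOff 4 n) n α x))) (vertexOfK (coDressKBmAt (ctr 4 n) n (KInvStep (d := 3) n 0)) n (fun κ u => ((n : ℝ) ^ 4) • wilsonA 3 κ u + (-((n : ℝ) ^ 8 / 2)) • symVhSAt (ctr 4 n) 3 n rfl κ u) ν₀ z₀)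
                - comp (vertexOfK (coDressKBmAt (ctr 4 n) n (KInvStep (d := 3) n 0)) n (fun κ u => ((n : ℝ) ^ 4) • wilsonA 3 κ u + (-((n : ℝ) ^ 8 / 2)) • symVhSAt (ctr 4 n) 3 n rfl κ u) ν₀ z₀) (diagK fun z b => -(∑ α : Fin (3 + 1), ∑ x ∈ blockSitesF n (blk n (legSite (ctr 4 n) z b)), colH (coDressKBmAt (ctr 4 n) n (KInvStep (d := 3) n 0)) n μ₀ 0 α x * (((n : ℝ) ^ 4 / 2) * faceWt (ctrOff 4 n) n α x))))))
            - (((comp (diagK fun z b => -(∑ α : Fin (3 + 1), ∑ x ∈ blockSitesF n (blk n (legSite (ctr 4 n) z b)), colH (coDressKBmAt (ctr 4 n) n (KInvStep (d := 3) n 0)) n ν₀ z₀ α x * (((n : ℝ) ^ 4 / 2) * faceWt (ctrOff 4 n) n α x))) (vertexOfK (coDressKBmAt (ctr 4 n) n (KInvStep (d := 3) n 0)) n (JsB12CombSh0 hodd N (symTablesAn1S2 3 n cΛ) cΛ (-((n : ℝ) ^ 12 / 4)) 0).S μ₀ 0)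
                - comp (vertexOfK (coDressKBmAt (ctr 4 n) n (KInvStep (d := 3) n 0)) n (JsB12CombSh0 hodd N (symTablesAn1S2 3 n cΛ) cΛ (-((n : ℝ) ^ 12 / 4)) 0).S μ₀ 0) (diagK fun z b => -(∑ α : Fin (3 + 1), ∑ x ∈ blockSitesF n (blk n (legSite (ctr 4 n) z b)), colH (coDressKBmAt (ctr 4 n) n (KInvStep (d := 3) n 0)) n ν₀ z₀ α x * (((n : ℝ) ^ 4 / 2) * faceWt (ctrOff 4 n) n α x))))
              + (comp (diagK fun z b => -(∑ α : Fin (3 + 1), ∑ x ∈ blockSitesF n (blk n (legSite (ctr 4 n) z b)), colH (coDressKBmAt (ctr 4 n) n (KInvStep (d := 3) n 0)) n μ₀ 0 α x * (((n : ℝ) ^ 4 / 2) * faceWt (ctrOff 4 n) n α x))) (vertexOfK (coDressKBmAt (ctr 4 n) n (KInvStep (d := 3) n 0)) n (JsB12CombSh0 hodd N (symTablesAn1S2 3 n cΛ) cΛ (-((n : ℝ) ^ 12 / 4)) 0).S ν₀ z₀)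
                - comp (vertexOfK (coDressKBmAt (ctr 4 n) n (KInvStep (d := 3) n 0)) n (JsB12CombSh0 hodd N (symTablesAn1S2 3 n cΛ) cΛ (-((n : ℝ) ^ 12 / 4)) 0).S ν₀ z₀) (diagK fun z b => -(∑ α : Fin (3 + 1), ∑ x ∈ blockSitesF n (blk n (legSite (ctr 4 n) z b)), colH (coDressKBmAt (ctr 4 n) n (KInvStep (d := 3) n 0)) n μ₀ 0 α x * (((n : ℝ) ^ 4 / 2) * faceWt (ctrOff 4 n) n α x)))))))
        + (1 / 2) * tadpole (coDressKBmAt (ctr 4 n) n (KInvStep (d := 3) n 0)) (comp (diagK fun z' b => (n : ℝ) ^ 4 / 2 * bmGaugeAt (ctr 4 n) (colH (KInvStep (d := 3) n 0) n ν₀ z₀) n (legSite (ctr 4 n) z' b))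
                (comp (diagK fun z' b => (n : ℝ) ^ 4 / 2 * bmGaugeAt (ctr 4 n) (colH (KInvStep (d := 3) n 0) n μ₀ 0) n (legSite (ctr 4 n) z' b)) (Dsh n)
              - comp (Dsh n) (diagK fun z' b => (n : ℝ) ^ 4 / 2 * bmGaugeAt (ctr 4 n) (colH (KInvStep (d := 3) n 0) n μ₀ 0) n (legSite (ctr 4 n) z' b)))
              - comp (comp (diagK fun z' b => (n : ℝ) ^ 4 / 2 * bmGaugeAt (ctr 4 n) (colH (KInvStep (d := 3) n 0) n μ₀ 0) n (legSite (ctr 4 n) z' b)) (Dsh n)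
              - comp (Dsh n) (diagK fun z' b => (n : ℝ) ^ 4 / 2 * bmGaugeAt (ctr 4 n) (colH (KInvStep (d := 3) n 0) n μ₀ 0) n (legSite (ctr 4 n) z' b)))
                (diagK fun z' b => (n : ℝ) ^ 4 / 2 * bmGaugeAt (ctr 4 n) (colH (KInvStep (d := 3) n 0) n ν₀ z₀) n (legSite (ctr 4 n) z' b)))
        + (1 / 2) * (bubble (coDressKBmAt (ctr 4 n) n (KInvStep (d := 3) n 0)) (vertexOfK (KInvStep (d := 3) n 0) n (JsB12CombSh0 hodd N (symTablesAn1S2 3 n cΛ) cΛ (-((n : ℝ) ^ 12 / 4)) 0).S μ₀ 0) (comp (diagK fun z' b => (n : ℝ) ^ 4 / 2 * bmGaugeAt (ctr 4 n) (colH (KInvStep (d := 3) n 0) n ν₀ z₀) n (legSite (ctr 4 n) z' b)) (Dsh n)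
              - comp (Dsh n) (diagK fun z' b => (n : ℝ) ^ 4 / 2 * bmGaugeAt (ctr 4 n) (colH (KInvStep (d := 3) n 0) n ν₀ z₀) n (legSite (ctr 4 n) z' b)))
            + bubble (coDressKBmAt (ctr 4 n) n (KInvStep (d := 3) n 0)) (comp (diagK fun z' b => (n : ℝ) ^ 4 / 2 * bmGaugeAt (ctr 4 n) (colH (KInvStep (d := 3) n 0) n μ₀ 0) n (legSite (ctr 4 n) z' b)) (Dsh n)
              - comp (Dsh n) (diagK fun z' b => (n : ℝ) ^ 4 / 2 * bmGaugeAt (ctr 4 n) (colH (KInvStep (d := 3) n 0) n μ₀ 0) n (legSite (ctr 4 n) z' b))) (vertexOfK (KInvStep (d := 3) n 0) n (JsB12CombSh0 hodd N (symTablesAn1S2 3 n cΛ) cΛ (-((n : ℝ) ^ 12 / 4)) 0).S ν₀ z₀))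
        + (1 / 2) * bubble (coDressKBmAt (ctr 4 n) n (KInvStep (d := 3) n 0)) (comp (diagK fun z' b => (n : ℝ) ^ 4 / 2 * bmGaugeAt (ctr 4 n) (colH (KInvStep (d := 3) n 0) n μ₀ 0) n (legSite (ctr 4 n) z' b)) (Dsh n)
              - comp (Dsh n) (diagK fun z' b => (n : ℝ) ^ 4 / 2 * bmGaugeAt (ctr 4 n) (colH (KInvStep (d := 3) n 0) n μ₀ 0) n (legSite (ctr 4 n) z' b))) (comp (diagK fun z' b => (n : ℝ) ^ 4 / 2 * bmGaugeAt (ctr 4 n) (colH (KInvStep (d := 3) n 0) n ν₀ z₀) n (legSite (ctr 4 n) z' b)) (Dsh n)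
              - comp (Dsh n) (diagK fun z' b => (n : ℝ) ^ 4 / 2 * bmGaugeAt (ctr 4 n) (colH (KInvStep (d := 3) n 0) n ν₀ z₀) n (legSite (ctr 4 n) z' b))) := by
  -- BOTH PINS (instantiated first, so that the abbreviations below rewrite inside them)
  have eL := hessKer_literal_record_eq hodd hτ ho hN c cΛ μ₀ ν₀ z₀
  have eR := hessKer_G0bm_record_eq hodd hτ ho hN c cΛ μ₀ ν₀ z₀
  -- abbreviations
  set K₀ : MKer (3 + 1) (Fib 3) := KInvStep (d := 3) n 0 with hK₀def
  set G₀ : MKer (3 + 1) (Fib 3) := coDressKBmAt (ctr 4 n) n K₀ with hG₀def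
  set S0 := (JsB12CombSh0 hodd N (symTablesAn1S2 3 n cΛ) cΛ (-((n : ℝ) ^ 12 / 4)) 0).S with hS0def
  set Sfl : Fin (3 + 1) → Site (3 + 1) → MKer (3 + 1) (Fib 3) :=
    fun κ u => ((n : ℝ) ^ 4) • wilsonA 3 κ u + (-((n : ℝ) ^ 8 / 2)) • symVhSAt (ctr 4 n) 3 n rfl κ u with hSfldef
  set M0 := (symTablesAn1S2 3 n cΛ).M 0 with hM0def
  set S₂ : Fin (3 + 1) → Site (3 + 1) → Fin (3 + 1) → Site (3 + 1) → MKer (3 + 1) (Fib 3) :=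
    fun κ u κ' u' => ((n : ℝ) ^ 8) • wilsonW₂ 3 ((8 * (N : ℝ) ^ 2)⁻¹ • wsym22 N) κ u κ' u' + (-((n : ℝ) ^ 12 / 4)) • symVh₂SAn1 3 n κ u κ' u' with hS₂def
  set M₂ := M2Of 3 n (symTablesAn1S2 3 n cΛ).mixFF 0 with hM₂def
  have hn1 : 1 ≤ n := Nat.one_le_iff_ne_zero.2 (NeZero.ne n)
  have hn0 : 0 < n := hn1
  -- structural facts about the kernels and the record's tables (the sockets of both pins)
  have hK₀ : Spr K₀ := spr_KInvStep (d := 3) (Lc := n) 0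
  have hG₀ : Spr G₀ := spr_G0bm_ctr (d := 3) (Lc := n)
  have hG' : Spr (GcombSh (d := 3) n 0) := spr_GcombSh_zero (d := 3) (Lc := n)
  have hins : (GcombSh (d := 3) n 0) = G₀ - comp (comp G₀ (Dsh n)) (GcombSh (d := 3) n 0) := GcombSh_zero_eq_sub_defect (d := 3) (Lc := n)
  obtain ⟨CG, δG, hδG, hGd⟩ : Spr G₀ := spr_G0bm_ctr (d := 3) (Lc := n)
  obtain ⟨δK, CK, hδK, hCK, hKd⟩ := OneStepResolventKernel.decays_KInv (N := n) (d := 3)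
  obtain ⟨Cs, -, hS⟩ := locStencil_JsB12CombSh0_S_zero_of_decays hodd N (symTablesAn1S2 3 n cΛ) cΛ (-((n : ℝ) ^ 12 / 4)) hKd hCK hδK
  obtain ⟨Cfl, -, hSfl⟩ := locStencil_pure_zero (n := n) (symTablesAn1S2 3 n cΛ) (δ := 1) zero_le_one
  obtain ⟨CM, δM, hδM, hM0⟩ := (symTablesAn1S2 3 n cΛ).hM 0
  obtain ⟨C₂, δ₂, hδ₂, hS₂⟩ := locStencil₂_T2RecOf_symTablesAn1 (Lc := n) N cΛ 0
  rw [T2RecOf_zero_level] at hS₂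
  have hC₂ : 0 ≤ C₂ := hS₂.nonneg
  obtain ⟨CF, δF, hδF, hM₂⟩ := locStencilFM_literalM₂ n (symTablesAn1S2 3 n cΛ)
  -- g53's block envelope of the straight column ⇒ the column generator `Λc` is localised
  have hcol : ∀ (μ' : Fin (3 + 1)) (y : Site (3 + 1)) (κ : Fin (3 + 1)) (u : Site (3 + 1)), |colH K₀ n μ' y κ u|
      ≤ ((n : ℝ) ^ (3 + 2))⁻¹ * (MG163 (3 + 1) * periodConst (kappa163 (3 + 1)) 3)
          * Real.exp (-(kappa163 (3 + 1) / ((3 : ℝ) + 1) * supNorm (quo n u - y))) :=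
    fun μ' y κ u => abs_colH_KInvStep_zero_le (d := 3) (N := n) hn1 μ' y κ u
  have hM : 0 ≤ ((n : ℝ) ^ (3 + 2))⁻¹ * (MG163 (3 + 1) * periodConst (kappa163 (3 + 1)) 3) :=
    (mul_nonneg_iff_of_pos_right (Real.exp_pos _)).1 ((abs_nonneg _).trans (hcol 0 0 0 0))
  have hc : 0 < kappa163 (3 + 1) / ((3 : ℝ) + 1) := div_pos (kappa163_pos (3 + 1)) (by positivity)
  have hΛ : ∀ μ y, Loc (diagK fun z' b => (n : ℝ) ^ 4 / 2 * bmGaugeAt (ctr 4 n) (colH K₀ n μ y) n (legSite (ctr 4 n) z' b)) := fun μ y => by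
    have hχ := abs_bmGaugeAt_weight_le hn1 (ctrOff_mem_box hn1) K₀ μ y hM hc.le (hcol μ y)
    exact loc_diagK_weight_legSite (by positivity) (by positivity) hχ (ctr 4 n) ((n : ℝ) ^ 4 / 2)
  have hGD : ∀ μ y, Loc (comp (diagK fun z' b => (n : ℝ) ^ 4 / 2 * bmGaugeAt (ctr 4 n) (colH K₀ n μ y) n (legSite (ctr 4 n) z' b)) (Dsh n)
              - comp (Dsh n) (diagK fun z' b => (n : ℝ) ^ 4 / 2 * bmGaugeAt (ctr 4 n) (colH K₀ n μ y) n (legSite (ctr 4 n) z' b))) := fun μ y => loc_comm_spr (spr_Dsh hn1) (hΛ μ y)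
  -- localisation of the straight families at `K₀`
  have hV : ∀ μ y, Loc (vertexOfK K₀ n S0 μ y) := fun μ y => loc_vertexOfK_of_spr hK₀ hS (half_pos hδK) μ y
  have hVfl : ∀ μ y, Loc (vertexOfK K₀ n Sfl μ y) := fun μ y => loc_vertexOfK_of_spr hK₀ hSfl one_pos μ y
  have hW2 : ∀ μ y ν y', Loc (vertex2OfK K₀ n S₂ μ y ν y') := fun μ y ν y' => loc_vertex2OfK_of_spr hK₀ hS₂ hC₂ hδ₂ μ y ν y'
  have hmix : ∀ μ y ν y', Loc (mixOfK K₀ n M₂ μ y ν y') := fun μ y ν y' => loc_mixOfK_of_spr hK₀ hM₂ hδF μ y ν y'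
  have hRG : ∀ μ y ν y', Loc (dM (K2OfK K₀ n Sfl M0 ν y') n Sfl M0 μ y) := fun μ y ν y' =>
    loc_dM_K2OfK hn0 hK₀ (S := Sfl) hSfl one_pos (M := M0) hM0 hδM ν y' μ y
  have hW2S : ∀ μ y ν y', Loc (W2SymOfK K₀ n Sfl M0 S₂ M₂ μ y ν y') := fun μ y ν y' => by
    unfold W2SymOfK
    exact (((((hW2 μ y ν y').add (hmix μ y ν y')).add (hmix ν y' μ y)).add (hRG μ y ν y')).add
      ((((hW2 ν y' μ y).add (hmix ν y' μ y)).add (hmix μ y ν y')).add (hRG ν y' μ y))).smul _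
  have hWΛc := fun (μ : Fin (3 + 1)) (y : Site (3 + 1)) (ν : Fin (3 + 1)) (y' : Site (3 + 1)) =>
    ((((hΛ ν y').comp (hVfl μ y)).sub ((hVfl μ y).comp (hΛ ν y'))).add
        (((hΛ μ y).comp (hVfl ν y')).sub ((hVfl ν y').comp (hΛ μ y)))).sub
      ((((hΛ ν y').comp (hV μ y)).sub ((hV μ y).comp (hΛ ν y'))).add
        (((hΛ μ y).comp (hV ν y')).sub ((hV ν y').comp (hΛ μ y))))
  have hWDD := fun (μ : Fin (3 + 1)) (y : Site (3 + 1)) (ν : Fin (3 + 1)) (y' : Site (3 + 1)) =>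
    ((hΛ ν y').comp (hGD μ y)).sub ((hGD μ y).comp (hΛ ν y'))
  -- localisation of the words at `G₀` (the chart layer's sockets)
  have hmixG : ∀ μ y ν y', Loc (mixOfK G₀ n M₂ μ y ν y') := fun μ y ν y' => loc_mixOfK_of_spr hG₀ hM₂ hδF μ y ν y'
  have hWMcol := fun (μ : Fin (3 + 1)) (y : Site (3 + 1)) (ν : Fin (3 + 1)) (y' : Site (3 + 1)) =>
    ((hmixG μ y ν y').sub (hmix μ y ν y')).add ((hmixG ν y' μ y).sub (hmix ν y' μ y))
  have hHv : VertexFamily (symHessFFAt (ctr 4 n) n) n (2 * (ell (3 + 1) n : ℝ) ^ 2 * Real.exp (4 * ((3 : ℝ) + 1) * n * 1)) 1 :=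
    vertexFamily_symHessFFAt (d := 3) hn1 (ctrOff_mem_box hn1) zero_le_one
  have hA := locStencilFM_anchor (d := 3) hn1 hHv zero_le_one (ctr 4 n) (ctrOff 4 n) (2 : ℝ)
  have hmixA : ∀ μ y ν y', Loc (mixOfK G₀ n (fun κ u ρ w => (if blk n ((n : ℤ) • w + (ctr 4 n)) = blk n u then 2 * faceWt (ctrOff 4 n) n κ u else 0) • (symHessFFAt (ctr 4 n) n) ρ w) μ y ν y') :=
    fun μ y ν y' => loc_mixOfK_of_spr hG₀ hA one_pos μ y ν y'
  have hVM : ∀ ν y', Loc (vertexOfM G₀ n (symHessFFAt (ctr 4 n) n) ν y') := fun ν y' => by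
    have hm : 0 < min δG 1 := lt_min hδG one_pos
    have hKm : ExpKernelCalculus.Decays G₀ |CG| (min δG 1) := decays_of_le hGd (min_le_left _ _)
    have hC1 : 0 ≤ 2 * (ell (3 + 1) n : ℝ) ^ 2 * Real.exp (4 * ((3 : ℝ) + 1) * n * 1) := by positivity
    have hMm := vertexFamily_mono' hHv hC1 (min_le_right δG 1)
    have hV := vertexFamily_vertexOfM (N := n) hKm (abs_nonneg CG) hMm hm le_rfl
    exact ⟨_, _, _, _, half_pos hm, hV ν y'⟩
  have hΘ : ∀ μ y, Loc (diagK fun z b => ∑ α : Fin (3 + 1), ∑ x ∈ blockSitesF n (blk n (legSite (ctr 4 n) z b)), colH G₀ n μ y α x * (2 * faceWt (ctrOff 4 n) n α x)) :=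
    fun μ y => loc_faceGen hn0 hG₀ (ctr 4 n) (ctrOff 4 n) 2 μ y
  have hWMs := fun (μ : Fin (3 + 1)) (y : Site (3 + 1)) (ν : Fin (3 + 1)) (y' : Site (3 + 1)) =>
    ((hmixA μ y ν y').add (hmixA ν y' μ y)).sub (((hΘ μ y).comp (hVM ν y')).add ((hΘ ν y').comp (hVM μ y)))
  have hΛf : ∀ μ y, Loc (diagK fun z b => -(∑ α : Fin (3 + 1), ∑ x ∈ blockSitesF n (blk n (legSite (ctr 4 n) z b)), colH G₀ n μ y α x * (((n : ℝ) ^ 4 / 2) * faceWt (ctrOff 4 n) n α x))) :=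
    fun μ y => loc_faceGauge hn0 hGd hδG (ctr 4 n) (ctrOff 4 n) ((n : ℝ) ^ 4 / 2) μ y
  have hVG : ∀ μ y, Loc (vertexOfK G₀ n S0 μ y) := fun μ y => loc_vertexOfK_of_spr hG₀ hS (half_pos hδK) μ y
  have hVflG : ∀ μ y, Loc (vertexOfK G₀ n Sfl μ y) := fun μ y => loc_vertexOfK_of_spr hG₀ hSfl one_pos μ y
  have hWΛf := fun (μ : Fin (3 + 1)) (y : Site (3 + 1)) (ν : Fin (3 + 1)) (y' : Site (3 + 1)) =>
    ((((hΛf ν y').comp (hVflG μ y)).sub ((hVflG μ y).comp (hΛf ν y'))).add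
        (((hΛf μ y).comp (hVflG ν y')).sub ((hVflG ν y').comp (hΛf μ y)))).sub
      ((((hΛf ν y').comp (hVG μ y)).sub ((hVG μ y).comp (hΛf ν y'))).add
        (((hΛf μ y).comp (hVG ν y')).sub ((hVG ν y').comp (hΛf μ y))))
  have hWL := fun (μ : Fin (3 + 1)) (y : Site (3 + 1)) (ν : Fin (3 + 1)) (y' : Site (3 + 1)) =>
    (((hW2S μ y ν y').add (hWΛc μ y ν y')).add (hWMcol μ y ν y')).add ((hWMs μ y ν y').add (hWΛf μ y ν y'))
  -- the literal at its own kernel (α-form; TT8 `JsB12CombSh0_W_zero_eq` is `rfl`)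
  have eT : TOf (N := n) (JsB12CombShSym hodd N (symTablesAn1S2 3 n cΛ) cΛ (-((n : ℝ) ^ 12 / 4)) 0) μ₀ ν₀ z₀
      = hessKer (GcombSh (d := 3) n 0) (vertexOfK (GcombSh (d := 3) n 0) n S0) (W2SymOfK (GcombSh (d := 3) n 0) n Sfl M0 S₂ M₂) μ₀ ν₀ z₀ := by
    rw [TOf_JsB12CombShSym_eq_hessKer_GcombSh n hodd N (symTablesAn1S2 3 n cΛ) cΛ (-((n : ℝ) ^ 12 / 4))]
    rfl
  -- the three one-insertion identities and the both-slots bubble expansion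
  have ht := tadpole_sub_tadpole_of_insertion hG₀ hG' hins (hWL μ₀ 0 ν₀ z₀)
  have hb := bubble_sub_bubble_of_insertion hG₀ hG' hins (hV μ₀ 0) (hV ν₀ z₀)
  have hbb := bubble_add_add hG₀ (hV μ₀ 0) (hGD μ₀ 0) (hV ν₀ z₀) (hGD ν₀ z₀)
  -- the `G₀`-tadpole of the literal pin's family splits word by word
  rw [tadpole_add hG₀ (((hW2S μ₀ 0 ν₀ z₀).add (hWΛc μ₀ 0 ν₀ z₀)).add (hWMcol μ₀ 0 ν₀ z₀)) ((hWMs μ₀ 0 ν₀ z₀).add (hWΛf μ₀ 0 ν₀ z₀)),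
    tadpole_add hG₀ ((hW2S μ₀ 0 ν₀ z₀).add (hWΛc μ₀ 0 ν₀ z₀)) (hWMcol μ₀ 0 ν₀ z₀),
    tadpole_add hG₀ (hW2S μ₀ 0 ν₀ z₀) (hWΛc μ₀ 0 ν₀ z₀), tadpole_add hG₀ (hWMs μ₀ 0 ν₀ z₀) (hWΛf μ₀ 0 ν₀ z₀)] at ht
  -- ASSEMBLY: literal and road words through the pins, `hessKer` unfolded, the road's tadpole split, the (D-R) row split
  rw [eT, eL, eR]
  unfold ExpKernelCalculus.hessKer
  rw [tadpole_sub hG₀ ((hW2 μ₀ 0 ν₀ z₀).add (hWΛc μ₀ 0 ν₀ z₀)) (hWDD μ₀ 0 ν₀ z₀),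
    tadpole_add hG₀ (hW2 μ₀ 0 ν₀ z₀) (hWΛc μ₀ 0 ν₀ z₀), tadpole_sub hG₀ (hW2S μ₀ 0 ν₀ z₀) (hW2 μ₀ 0 ν₀ z₀)]
  linear_combination (1 / 2 : ℝ) * ht - (1 / 2 : ℝ) * hb + (1 / 2 : ℝ) * hbb

end Summit.QuantumFields.BalabanUV.Beta.D1BFx.ChartDefectTwoPins

end
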